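import Summits.KontsevichZagierPeriods.Zeta5Search.WellPoisedInteriorOddPhiRate
import HarnessLib.Audit
import HarnessLib

/-!
# The `Φ`-rate (8.10) in the interior, part 2: certificates, the product bound and the PNT limit —
# cell `pub-zeta5`, class `odd` (gen 65), SCOREBOARD §E "no-go theorem"

HONEST FRAMING: systematic search; no irrationality claim unless certified.  Part 1 (`WellPoisedInteriorOddPhiRate`)
proved the local facts: `ν_p ≤ M + 8` always, `ν_p ≤ F_c(n/p)` at an admissible offset-free witness, and
`F_c ≤ U_c(a,b) ≤ g` on a checked piece `n/p ∈ [a, b)`.  This part assembles them: a `PhiCert` is a chain of checked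
pieces covering `[1/μ, N₀)` (`IntDir.certCheck`, a `Bool` the kernel evaluates), and for a checked certificate
`Φ(h_n) ≤ (∏_{p ≤ n/N₀} p)^{M+8} · ∏_pieces (∏_{n/b < p ≤ n/a} p)^{g}` for EVERY `n` (`intPhi_le_cert`), whence by the
prime number theorem window by window (the tree's `Hata1992.tendsto_log_windowProd_div`) `∀ ε > 0, ∀ᶠ n,`
`log Φ(h_n) ≤ (φ̄ + ε) n` with `φ̄ = (M+8)/N₀ + Sub/D` (`log_intPhi_eventually_le`) — hypothesis `(ii)` of the tree's
`IntDir.interior_noGo` (p319103) DISCHARGED: `interior_noGo_cert` keeps only Lemma 20's decay floor `(i)` and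
`C₀ + φ̄ < δ`.  Instances (`decide +kernel` data): `WellPoisedInteriorOddPhiRateArgmax9` / `…Argmax11`.
Nothing here bears on `ζ(5)`; NEGATIVE-shaped; standard axioms; no Literature fact, no `@[conjecture]`.
-/

noncomputable section

open Real Finset Filter Topology

namespace Summit.KontsevichZagierPeriods.Zeta5Search

namespace WellPoisedFace

open Literature.NumberTheory.Irrationality.Hata1992 (windowPrimes windowProd mem_windowPrimes_iff
  windowProd_pos tendsto_log_windowProd_div prime_of_mem_windowPrimes)

/-- A `Φ`-RATE CERTIFICATE for a direction: pieces covering `[1/μ, N₀)` and the scale `D` of the weights. -/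
structure PhiCert where
  /-- the `x ≥ N₀` cut: primes `p ≤ n/N₀` are charged `M + 8` each -/ N0 : ℕ
  /-- fixed-point scale of the weights -/ D : ℕ
  /-- the pieces, left to right -/ pieces : List PhiPiece

namespace PhiCert

/-- The pieces form a chain from `lo` to (at least) `hi`: each starts at or before the running point. -/
def chainOK : ℚ → List PhiPiece → ℚ → Bool
  | s, [], t => decide (t ≤ s)
  | s, P :: L, t => decide (P.a ≤ s) && chainOK P.b L t

/-- A chain covers `[lo, hi)`: every such point lies in some piece. -/
theorem cover {L : List PhiPiece} {lo hi : ℚ} (h : chainOK lo L hi = true) {x : ℚ} (hlo : lo ≤ x)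
    (hhi : x < hi) : ∃ P ∈ L, P.a ≤ x ∧ x < P.b := by
  induction L generalizing lo with
  | nil =>
    simp only [chainOK, decide_eq_true_eq] at h
    exact absurd (h.trans hlo) (not_le.2 hhi)
  | cons P L ih =>
    simp only [chainOK, Bool.and_eq_true, decide_eq_true_eq] at h
    by_cases hx : x < P.b
    · exact ⟨P, List.mem_cons.2 (Or.inl rfl), h.1.trans hlo, hx⟩
    · obtain ⟨Q, hQ, h1, h2⟩ := ih h.2 (not_lt.1 hx)
      exact ⟨Q, List.mem_cons.2 (Or.inr hQ), h1, h2⟩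

/-- `Sub = Σ ub`, the `D`-scaled weight of the certificate. -/
def Sub (c : PhiCert) : ℕ := (c.pieces.map PhiPiece.ub).sum

/-- The real rate `Σ_pieces g · (1/a − 1/b)` of a list of pieces. -/
def rate (L : List PhiPiece) : ℝ := (L.map fun P : PhiPiece => (P.g : ℝ) * (1 / (P.a : ℝ) - 1 / (P.b : ℝ))).sum

/-- The window product `∏_pieces (∏_{n/b < p ≤ n/a} p)^g` of a list of pieces. -/
def wprod (L : List PhiPiece) (n : ℕ) : ℕ :=
  (L.map fun P : PhiPiece => windowProd (1 / (P.b : ℝ)) (1 / (P.a : ℝ)) n ^ P.g).prod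

/-- `wprod > 0`. -/
theorem wprod_pos (L : List PhiPiece) (n : ℕ) : 0 < wprod L n := by
  unfold wprod
  induction L with
  | nil => simp
  | cons P L ih =>
    rw [List.map_cons, List.prod_cons]
    exact Nat.mul_pos (pow_pos (windowProd_pos _ _ _) _) ih

/-- PNT piece by piece: `(1/n) log wprod → rate` when every piece has `0 < a < b`. -/
theorem tendsto_log_wprod_div (L : List PhiPiece) (hL : ∀ P ∈ L, 0 < P.a ∧ P.a < P.b) :
    Tendsto (fun n : ℕ => Real.log (wprod L n : ℕ) / n) atTop (𝓝 (rate L)) := by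
  induction L with
  | nil =>
    simp only [wprod, rate, List.map_nil, List.prod_nil, List.sum_nil, Nat.cast_one, Real.log_one, zero_div]
    exact tendsto_const_nhds
  | cons P L ih =>
    have hP := hL P (List.mem_cons.2 (Or.inl rfl))
    have hL' : ∀ Q ∈ L, 0 < Q.a ∧ Q.a < Q.b := fun Q hQ => hL Q (List.mem_cons.2 (Or.inr hQ))
    have ha : (0 : ℝ) < P.a := by exact_mod_cast hP.1
    have hb : (0 : ℝ) < P.b := by exact_mod_cast (hP.1.trans hP.2)
    have hab : (P.a : ℝ) < P.b := by exact_mod_cast hP.2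
    have h1 : (0 : ℝ) ≤ 1 / (P.b : ℝ) := by positivity
    have h2 : 1 / (P.b : ℝ) ≤ 1 / (P.a : ℝ) := one_div_le_one_div_of_le ha hab.le
    have hw := (tendsto_log_windowProd_div h1 h2).const_mul (P.g : ℝ)
    have hsum := hw.add (ih hL')
    have e : rate (P :: L) = (P.g : ℝ) * (1 / (P.a : ℝ) - 1 / (P.b : ℝ)) + rate L := by
      simp only [rate, List.map_cons, List.sum_cons]
    rw [e]
    refine hsum.congr fun n => ?_
    have hwp : (0 : ℝ) < (windowProd (1 / (P.b : ℝ)) (1 / (P.a : ℝ)) n : ℕ) := by exact_mod_cast windowProd_pos _ _ _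
    have hr : (0 : ℝ) < (wprod L n : ℕ) := by exact_mod_cast wprod_pos L n
    have ew : (wprod (P :: L) n : ℕ) = windowProd (1 / (P.b : ℝ)) (1 / (P.a : ℝ)) n ^ P.g * wprod L n := by
      simp only [wprod, List.map_cons, List.prod_cons]
    rw [ew, Nat.cast_mul, Nat.cast_pow, Real.log_mul (pow_ne_zero _ hwp.ne') hr.ne', Real.log_pow]
    ring

/-- The `D`-scaled bookkeeping: `rate ≤ (Σ ub)/D` when every piece passes the checker (`D > 0`). -/
theorem rate_le (L : List PhiPiece) {η₀ a4 : ℕ} {heads tails : List ℕ} {D : ℕ} (hD : 0 < D)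
    (hL : ∀ P ∈ L, P.check η₀ a4 heads tails D = true) :
    rate L ≤ (((L.map PhiPiece.ub).sum : ℕ) : ℝ) / D := by
  induction L with
  | nil => simp [rate]
  | cons P L ih =>
    have hP := hL P (List.mem_cons.2 (Or.inl rfl))
    have ih' := ih fun Q hQ => hL Q (List.mem_cons.2 (Or.inr hQ))
    obtain ⟨han, had, hbd, hab, -, -, hub⟩ := P.check_spec hP
    have hbn : 0 < P.bn := by
      rcases Nat.eq_zero_or_pos P.bn with h0 | h0
      · rw [h0, Nat.zero_mul] at hab; exact absurd hab (Nat.not_lt_zero _)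
      · exact h0
    have han' : (0 : ℝ) < P.an := by exact_mod_cast han
    have had' : (0 : ℝ) < P.ad := by exact_mod_cast had
    have hbd' : (0 : ℝ) < P.bd := by exact_mod_cast hbd
    have hbn' : (0 : ℝ) < P.bn := by exact_mod_cast hbn
    have hD' : (0 : ℝ) < D := by exact_mod_cast hD
    have hub' : (D : ℝ) * P.g * (P.ad * P.bn) ≤ (P.ub : ℝ) * (P.an * P.bn) + D * P.g * (P.bd * P.an) := by
      exact_mod_cast hub
    have hterm : (P.g : ℝ) * (1 / (P.a : ℝ) - 1 / (P.b : ℝ)) ≤ (P.ub : ℝ) / D := by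
      have ea : (P.a : ℝ) = (P.an : ℝ) / P.ad := by unfold PhiPiece.a; push_cast; rfl
      have eb : (P.b : ℝ) = (P.bn : ℝ) / P.bd := by unfold PhiPiece.b; push_cast; rfl
      rw [ea, eb, one_div_div, one_div_div, le_div_iff₀ hD']
      have e1 : (P.g : ℝ) * ((P.ad : ℝ) / P.an - (P.bd : ℝ) / P.bn) * D
          = (D * P.g * (P.ad * P.bn) - D * P.g * (P.bd * P.an)) / (P.an * P.bn) := by
        field_simp
      rw [e1, div_le_iff₀ (mul_pos han' hbn')]
      linarith
    simp only [rate, List.map_cons, List.sum_cons, Nat.cast_add, add_div] at ih' ⊢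
    exact add_le_add hterm ih'

end PhiCert

namespace IntDir

variable {M : ℕ} (E : IntDir M)

/-- THE CERTIFICATE CHECKER for a direction: `N₀, D > 0`, every piece passes `PhiPiece.check` with the direction's
`η₀`, `η₄`, heads and tails, and the pieces chain from `1/μ` (`μ = μ(η_q) = M_{q−3}/n`) to at least `N₀`. -/
def certCheck (c : PhiCert) : Bool :=
  decide (0 < c.N0) && decide (0 < c.D)
    && c.pieces.all (fun P => P.check E.η₀ E.a (List.ofFn E.head) (List.ofFn E.tail) c.D)
    && PhiCert.chainOK ((1 : ℚ) / (E.imu E.d : ℕ)) c.pieces c.N0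

/-- THE CERTIFIED RATE `φ̄ = (M + 8)/N₀ + Sub/D`. -/
def phiBar (_E : IntDir M) (c : PhiCert) : ℝ := ((M + 8 : ℕ) : ℝ) / c.N0 + (c.Sub : ℝ) / c.D

/-- What the certificate checker says. -/
theorem certCheck_spec {c : PhiCert} (h : E.certCheck c = true) :
    0 < c.N0 ∧ 0 < c.D ∧ (∀ P ∈ c.pieces, P.check E.η₀ E.a (List.ofFn E.head) (List.ofFn E.tail) c.D = true)
      ∧ PhiCert.chainOK ((1 : ℚ) / (E.imu E.d : ℕ)) c.pieces c.N0 = true := by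
  simpa [certCheck, Bool.and_eq_true, decide_eq_true_eq, List.all_eq_true, and_assoc] using h

/-- **PIECE SOUNDNESS**: on a checked piece, `ν_p ≤ g` at every `(n, p)` with `n/p ∈ [a, b)`. -/
theorem nuPq_le_g (P : PhiPiece) {D : ℕ} (hP : P.check E.η₀ E.a (List.ofFn E.head) (List.ofFn E.tail) D = true)
    {n p : ℕ} (hp : 0 < p) (hax : P.a ≤ (n : ℚ) / p) (hxb : (n : ℚ) / p < P.b) :
    nuPq (E.h0 n) (E.hP n 0) (E.hP n 1) (E.hP n 2) (E.hT n) (E.hT n 0) p ≤ P.g := by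
  obtain ⟨-, had, hbd, -, hadm, hU, -⟩ := P.check_spec hP
  obtain ⟨m, hlo, hhi⟩ := E.adm_sound P hadm hp hax had
  exact (E.nuPq_le_wnu n P.c m hp hlo hhi).trans ((E.wnu_le_U P hbd hax hxb).trans hU)

/-! ### 4. `Φ(h_n) ≤ (∏_{p ≤ n/N₀} p)^{M+8} · ∏_pieces (∏_{n/b < p ≤ n/a} p)^g` and the PNT -/

/-- The pointwise exponent bound in product form: for a prime `p ≤ μ n` of `Φ(h_n)`,
`p^{ν_p} ≤ p^{(M+8)·[p ≤ n/N₀]} · ∏_pieces p^{g·[n/b < p ≤ n/a]}`. -/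
theorem pow_nuPq_le {c : PhiCert} (hc : E.certCheck c = true) {n p : ℕ} (hp : p.Prime)
    (hpμ : p ≤ E.imu E.d * n) :
    p ^ (nuPq (E.h0 n) (E.hP n 0) (E.hP n 1) (E.hP n 2) (E.hT n) (E.hT n 0) p).toNat ≤
      p ^ (if p ∈ windowPrimes 0 (1 / (c.N0 : ℝ)) n then M + 8 else 0)
        * (c.pieces.map fun P : PhiPiece =>
            p ^ (if p ∈ windowPrimes (1 / (P.b : ℝ)) (1 / (P.a : ℝ)) n then P.g else 0)).prod := by
  obtain ⟨hN0, hD, hall, hchain⟩ := E.certCheck_spec hc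
  have hp0 : 0 < p := hp.pos
  have hνM : (nuPq (E.h0 n) (E.hP n 0) (E.hP n 1) (E.hP n 2) (E.hT n) (E.hT n 0) p).toNat ≤ M + 8 :=
    Int.toNat_le.2 (E.nuPq_le_M n hp0)
  have hone : ∀ L : List PhiPiece, 1 ≤ (L.map fun P : PhiPiece =>
      p ^ (if p ∈ windowPrimes (1 / (P.b : ℝ)) (1 / (P.a : ℝ)) n then P.g else 0)).prod := by
    intro L
    induction L with
    | nil => simp
    | cons P L ih =>
      rw [List.map_cons, List.prod_cons]
      exact one_le_mul (Nat.one_le_pow _ _ hp0) ih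
  by_cases hsmall : (p : ℝ) ≤ 1 / (c.N0 : ℝ) * n
  · -- `p ≤ n/N₀`: charged `M + 8`
    have hmem : p ∈ windowPrimes 0 (1 / (c.N0 : ℝ)) n := by
      rw [mem_windowPrimes_iff le_rfl]
      exact ⟨hp, by simpa using hp0, hsmall⟩
    rw [if_pos hmem]
    calc p ^ (nuPq (E.h0 n) (E.hP n 0) (E.hP n 1) (E.hP n 2) (E.hT n) (E.hT n 0) p).toNat
        ≤ p ^ (M + 8) := Nat.pow_le_pow_right hp0 hνM
      _ ≤ p ^ (M + 8) * _ := Nat.le_mul_of_pos_right _ (hone _)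
  · -- `n/N₀ < p ≤ μ n`: `x = n/p ∈ [1/μ, N₀)` lies in a piece
    push Not at hsmall
    have hN0' : (0 : ℝ) < c.N0 := by exact_mod_cast hN0
    have hp' : (0 : ℚ) < p := by exact_mod_cast hp0
    have hμ : 0 < E.imu E.d := E.imu_pos _
    have hμ' : (0 : ℚ) < (E.imu E.d : ℕ) := by exact_mod_cast hμ
    have hlo : (1 : ℚ) / (E.imu E.d : ℕ) ≤ (n : ℚ) / p := by
      rw [div_le_div_iff₀ hμ' hp', one_mul]
      exact_mod_cast hpμ.trans_eq (Nat.mul_comm _ _)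
    have hhi : (n : ℚ) / p < c.N0 := by
      have h1 : (n : ℝ) < c.N0 * p := by
        rw [div_mul_eq_mul_div, one_mul, div_lt_iff₀ hN0'] at hsmall
        linarith
      have h2 : (n : ℚ) < c.N0 * p := by exact_mod_cast h1
      rw [div_lt_iff₀ hp']
      exact h2
    obtain ⟨P, hPmem, hax, hxb⟩ := PhiCert.cover hchain hlo hhi
    have hPc := hall P hPmem
    have hab := P.a_pos_lt_b hPc
    have hνg := Int.toNat_le.2 (E.nuPq_le_g P hPc hp0 hax hxb)
    have hmem : p ∈ windowPrimes (1 / (P.b : ℝ)) (1 / (P.a : ℝ)) n := by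
      have hb0 : (0 : ℚ) < P.b := hab.1.trans hab.2
      have hb0' : (0 : ℝ) < P.b := by exact_mod_cast hb0
      have ha0' : (0 : ℝ) < P.a := by exact_mod_cast hab.1
      rw [mem_windowPrimes_iff (by positivity)]
      refine ⟨hp, ?_, ?_⟩
      · have h1 : (n : ℚ) < P.b * p := by rwa [div_lt_iff₀ hp'] at hxb
        have h2 : (n : ℝ) < (P.b : ℝ) * p := by exact_mod_cast h1
        rw [div_mul_eq_mul_div, one_mul, div_lt_iff₀ hb0']
        linarith
      · have h1 : P.a * p ≤ (n : ℚ) := by rwa [le_div_iff₀ hp'] at hax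
        have h2 : (P.a : ℝ) * p ≤ (n : ℝ) := by exact_mod_cast h1
        rw [div_mul_eq_mul_div, one_mul, le_div_iff₀ ha0']
        linarith
    have hdvd : p ^ P.g ∣ (c.pieces.map fun Q : PhiPiece =>
        p ^ (if p ∈ windowPrimes (1 / (Q.b : ℝ)) (1 / (Q.a : ℝ)) n then Q.g else 0)).prod := by
      apply List.dvd_prod
      rw [List.mem_map]
      exact ⟨P, hPmem, by rw [if_pos hmem]⟩
    have hle := Nat.le_of_dvd (lt_of_lt_of_le Nat.one_pos (hone _)) hdvd
    calc p ^ (nuPq (E.h0 n) (E.hP n 0) (E.hP n 1) (E.hP n 2) (E.hT n) (E.hT n 0) p).toNat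
        ≤ p ^ P.g := Nat.pow_le_pow_right hp0 hνg
      _ ≤ _ := hle
      _ ≤ _ := Nat.le_mul_of_pos_left _ (Nat.one_le_pow _ _ hp0)

/-- `∏_{p ∈ S} p^{g·[p ∈ W]} ≤ (∏_{p ∈ W} p)^g` for a set `W` of primes. -/
theorem prod_pow_indicator_le (S W : Finset ℕ) (hW : ∀ p ∈ W, p.Prime) (g : ℕ) :
    ∏ p ∈ S, p ^ (if p ∈ W then g else 0) ≤ (∏ p ∈ W, p) ^ g := by
  have step : ∀ p ∈ S, p ^ (if p ∈ W then g else 0) = if p ∈ W then p ^ g else 1 := by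
    intro p _
    split_ifs <;> simp
  rw [Finset.prod_congr rfl step, ← Finset.prod_filter, ← Finset.prod_pow]
  apply Finset.prod_le_prod_of_subset_of_one_le'
  · intro p hp
    exact (Finset.mem_filter.1 hp).2
  · intro p hp _
    exact Nat.one_le_pow _ _ (hW p hp).pos

/-- `∏_{p ∈ S} ∏_pieces p^{g·[p ∈ W_piece]} ≤ wprod`. -/
theorem prod_list_le_wprod (S : Finset ℕ) (L : List PhiPiece) (n : ℕ) :
    ∏ p ∈ S, (L.map fun P : PhiPiece =>
        p ^ (if p ∈ windowPrimes (1 / (P.b : ℝ)) (1 / (P.a : ℝ)) n then P.g else 0)).prod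
      ≤ PhiCert.wprod L n := by
  unfold PhiCert.wprod
  induction L with
  | nil => simp
  | cons P L ih =>
    simp only [List.map_cons, List.prod_cons]
    rw [Finset.prod_mul_distrib]
    refine Nat.mul_le_mul ?_ ih
    unfold windowProd
    exact prod_pow_indicator_le S _ (fun p hp => prime_of_mem_windowPrimes hp) P.g

/-- **`Φ(h_n) ≤ (∏_{p ≤ n/N₀} p)^{M+8} · wprod(n)`** for a checked certificate (every `n`). -/
theorem intPhi_le_cert {c : PhiCert} (hc : E.certCheck c = true) (n : ℕ) :
    E.intPhi n ≤ windowProd 0 (1 / (c.N0 : ℝ)) n ^ (M + 8) * PhiCert.wprod c.pieces n := by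
  unfold intPhi PhiQ
  set S := (Finset.Ioc (Nat.sqrt (E.h0 n).toNat) (E.intMZ n (Fin.last (M + 1))).toNat).filter Nat.Prime
    with hSdef
  have hS : ∀ p ∈ S, p.Prime ∧ p ≤ E.imu E.d * n := fun p hp => by
    refine ⟨(Finset.mem_filter.1 hp).2, ?_⟩
    have h := (Finset.mem_Ioc.1 (Finset.mem_filter.1 hp).1).2
    rwa [intMZ_toNat] at h
  calc ∏ p ∈ S, p ^ (nuPq (E.h0 n) (E.hP n 0) (E.hP n 1) (E.hP n 2) (E.hT n) (E.hT n 0) p).toNat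
      ≤ ∏ p ∈ S, (p ^ (if p ∈ windowPrimes 0 (1 / (c.N0 : ℝ)) n then M + 8 else 0)
          * (c.pieces.map fun P : PhiPiece =>
              p ^ (if p ∈ windowPrimes (1 / (P.b : ℝ)) (1 / (P.a : ℝ)) n then P.g else 0)).prod) :=
        Finset.prod_le_prod' fun p hp => E.pow_nuPq_le hc (hS p hp).1 (hS p hp).2
    _ = (∏ p ∈ S, p ^ (if p ∈ windowPrimes 0 (1 / (c.N0 : ℝ)) n then M + 8 else 0))
          * ∏ p ∈ S, (c.pieces.map fun P : PhiPiece =>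
              p ^ (if p ∈ windowPrimes (1 / (P.b : ℝ)) (1 / (P.a : ℝ)) n then P.g else 0)).prod :=
        Finset.prod_mul_distrib
    _ ≤ windowProd 0 (1 / (c.N0 : ℝ)) n ^ (M + 8) * PhiCert.wprod c.pieces n := by
        refine Nat.mul_le_mul ?_ (prod_list_le_wprod S c.pieces n)
        unfold windowProd
        exact prod_pow_indicator_le S _ (fun p hp => prime_of_mem_windowPrimes hp) (M + 8)

/-- **THE `Φ`-RATE IN THE KERNEL**: for a checked certificate and every `ε > 0`, eventually
`log Φ(h_n) ≤ (φ̄ + ε) n`. -/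
theorem log_intPhi_eventually_le {c : PhiCert} (hc : E.certCheck c = true) {ε : ℝ} (hε : 0 < ε) :
    ∀ᶠ n : ℕ in atTop, Real.log (E.intPhi n) ≤ (E.phiBar c + ε) * n := by
  obtain ⟨hN0, hD, hall, -⟩ := E.certCheck_spec hc
  have hN0' : (0 : ℝ) < c.N0 := by exact_mod_cast hN0
  have hpieces : ∀ P ∈ c.pieces, 0 < P.a ∧ P.a < P.b := fun P hP => P.a_pos_lt_b (hall P hP)
  -- the comparison sequence and its limit
  have hW := (tendsto_log_windowProd_div (a := 0) (b := 1 / (c.N0 : ℝ)) le_rfl (by positivity)).const_mul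
    ((M + 8 : ℕ) : ℝ)
  have hT := hW.add (PhiCert.tendsto_log_wprod_div c.pieces hpieces)
  have hrate : PhiCert.rate c.pieces ≤ (c.Sub : ℝ) / c.D := PhiCert.rate_le c.pieces hD hall
  have hlim : ((M + 8 : ℕ) : ℝ) * (1 / (c.N0 : ℝ) - 0) + PhiCert.rate c.pieces < E.phiBar c + ε := by
    unfold phiBar
    rw [sub_zero, mul_one_div]
    linarith
  have hev := (tendsto_order.1 hT).2 _ hlim
  filter_upwards [hev, eventually_ge_atTop 1] with n hn hn1
  have hnpos : (0 : ℝ) < n := by exact_mod_cast hn1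
  have hΦpos : (0 : ℝ) < E.intPhi n := by exact_mod_cast E.intPhi_pos n
  have hw0 : (0 : ℝ) < (windowProd 0 (1 / (c.N0 : ℝ)) n : ℕ) := by exact_mod_cast windowProd_pos _ _ _
  have hwp : (0 : ℝ) < (PhiCert.wprod c.pieces n : ℕ) := by exact_mod_cast PhiCert.wprod_pos _ _
  have hle : (E.intPhi n : ℝ) ≤ ((windowProd 0 (1 / (c.N0 : ℝ)) n : ℕ) : ℝ) ^ (M + 8)
      * ((PhiCert.wprod c.pieces n : ℕ) : ℝ) := by exact_mod_cast E.intPhi_le_cert hc n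
  have hlog : Real.log (E.intPhi n) ≤ ((M + 8 : ℕ) : ℝ) * Real.log (windowProd 0 (1 / (c.N0 : ℝ)) n : ℕ)
      + Real.log (PhiCert.wprod c.pieces n : ℕ) := by
    have h := Real.log_le_log hΦpos hle
    rwa [Real.log_mul (pow_ne_zero _ hw0.ne') hwp.ne', Real.log_pow] at h
  have hn' : ((M + 8 : ℕ) : ℝ) * Real.log (windowProd 0 (1 / (c.N0 : ℝ)) n : ℕ)
      + Real.log (PhiCert.wprod c.pieces n : ℕ) < (E.phiBar c + ε) * n := by
    have h := hn
    rw [← mul_div_assoc, ← add_div, div_lt_iff₀ hnpos] at h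
    exact h
  linarith

/-- **THE INTERIOR NO-GO WITH THE `Φ`-RATE DISCHARGED.**  At a direction carrying a checked `Φ`-certificate with
`C₀ + φ̄ < δ`: IF `(i)` for every `C > C₀`, `|F(h_n)| ≥ e^{−Cn}` infinitely often ([Zudilin2004, Lemma 20]:
`limsup (1/n) log |F(h_n)| = −C₀`, PRINTED — the ONLY remaining hypothesis), THEN the Lemma-19-normalised forms
`Λ_n = D(n)Φ(h_n)⁻¹F(h_n)` do not tend to `0`: Nesterenko's criterion / Proposition 5 cannot be fed from there. -/
theorem interior_noGo_cert {c : PhiCert} (hc : E.certCheck c = true) (C0 : ℝ) (hκ : C0 + E.phiBar c < E.intDelta)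
    (hL20 : ∀ C : ℝ, C0 < C → ∃ᶠ n : ℕ in atTop, Real.exp (-(C * n)) ≤ |E.intF n|) :
    ¬ Tendsto E.intLambda atTop (𝓝 0) := by
  refine E.interior_noGo C0 (E.phiBar c) hκ hL20 fun φ' hφ' => ?_
  have h := E.log_intPhi_eventually_le hc (ε := φ' - E.phiBar c) (by linarith)
  refine h.mono fun n hn => ?_
  have e : (E.phiBar c + (φ' - E.phiBar c)) * (n : ℝ) = φ' * n := by ring
  rwa [e] at hn

/-- Growth form: with the certificate, Lemma 20's floor `(i)` and any `ε < δ − C₀ − φ̄`, `|Λ_n| ≥ e^{εn}`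
infinitely often. -/
theorem interior_frequently_exp_le_cert {c : PhiCert} (hc : E.certCheck c = true) (C0 : ℝ) {ε : ℝ}
    (hε : ε < E.intDelta - C0 - E.phiBar c)
    (hL20 : ∀ C : ℝ, C0 < C → ∃ᶠ n : ℕ in atTop, Real.exp (-(C * n)) ≤ |E.intF n|) :
    ∃ᶠ n : ℕ in atTop, Real.exp (ε * n) ≤ |E.intLambda n| := by
  refine E.interior_frequently_exp_le C0 (E.phiBar c) hε hL20 fun φ' hφ' => ?_
  have h := E.log_intPhi_eventually_le hc (ε := φ' - E.phiBar c) (by linarith)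
  refine h.mono fun n hn => ?_
  have e : (E.phiBar c + (φ' - E.phiBar c)) * (n : ℝ) = φ' * n := by ring
  rwa [e] at hn

end IntDir

end WellPoisedFace

end Summit.KontsevichZagierPeriods.Zeta5Search

end
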